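import Summits.QuantumFields.YangMills.Theses.MirrorModularBoosts

/-!
# Disproof of `PlanarSpectralCone` — findings (standing disprover, crux stmt-QuantumFields-9664)

Crux (route `MirrorModularBoosts`, item (C), model-blind): a translation-invariant, symmetric (E3),
linear-growth (E0') one-species Schwinger family on `ℝ⁴`, reflection positive in pull-back form
for the eight frames whose time axis is `±e₀, ±e₁, (±e₀ ± e₁)/√2`, has the PLANAR SPECTRAL CONE:
for time-ordered `F, G` the matrix element `(t,b) ↦ 𝔖(ΘF̄ ⊗ G_(t e₀ + b e₁))` is the restriction of
a function holomorphic on `{(ζ,β) : |Im β| < Re ζ}` bounded by `‖Ψ_F‖ ‖Ψ_G‖` (`spec(H,P₁) ⊂ {E ≥ |p₁|}`).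

VERDICT SO FAR: **resists** — no refutation; the statement is very probably TRUE and, if anything,
OVER-hypothesised. Findings, each realised below as a Lean declaration (proofs where cheap,
`sorry` only on the paper-level counterexamples of §2, with the witness in the docstring):

* §0 `crux_iff` — the crux split into named hypotheses `TransInv`, `EightFrames` and conclusion
  `Concl` (definitional, `Iff.rfl`).
* §1 JUNK MODELS PASS (proved): the zero family and the vacuum-only family satisfy all hypotheses
  in all eight frames AND the conclusion (`crux_at_zero`, `crux_at_vacuumOnly`); contact terms at
  coincident planar projections are invisible to hypotheses and conclusion alike. No junk handle.
* §2 LOAD-BEARING ANALYSIS: `false_without_diagonalFrames` (slow-light free field `c < 1`: RP in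
  the four axis frames, cone violated), `false_without_translation` (conformally weighted massless
  free field), `false_without_timeFrames` (sheared free field `Q = (1+κ)p_u² + (1−κ)p_v²`: RP across
  both diagonals, both orientations, but `𝔖₂` continues to a function SINGULAR inside the typed
  domain) — paper witnesses, sorried (each needs a Gaussian `SchwingerFamily` with its spectral
  representation, not in the tree). Conversely `sharpened_implies_crux` (proved): the crux follows
  from `SharpenedCone`, the same conclusion from ONLY E3 + translations + RP in the THREE frames
  `e₀, (e₀+e₁)/√2, (e₀−e₁)/√2` and no E0' — the disprover's reading of the proof (§ "Why it
  resists") uses nothing else; E0', the `±e₁` frames and the three backward frames look idle.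
* §3 WHY GAUSSIAN COUNTEREXAMPLES FAIL (proved algebra): `dispersion_rigidity` — reflection
  SYMMETRY across one diagonal already pins a single-shell dispersion `Λ(p₁) = p₁² + Λ 0` (speed of
  light 1); `lightCone_crossing` / `diag_discriminant_neg` — for the two-shell quartic family
  `P_ε = (p²+a)(p²+b) + ε p₀²p₁²` the axis Stieltjes property needs `ε ≥ 0`, where the cone is
  violated, while the diagonal Stieltjes property needs `ε ≤ 0`: convex in one frame is concave in
  the 45° frame. More to the point, the Gaussian (two-point) case is a THEOREM (docstring of
  `gaussian_case_note`): cross theorem in light-cone variables + positivity.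
* §4 GEOMETRY OF THE INTENDED PROOF (proved): `CrossTheoremQuadrant` states EXACTLY the one SCV input
  (classical cross theorem, half-plane/half-line case — in the tree as `LogSlot.IsSectorData.*`,
  OSSectorContinuation.lean); `cross_slice_iff_disc` — at real time `t` the
  Siciak–Zahariuta envelope `{|arg u| + |arg u'| < π/2}` meets the complex `x₁`-line in the DISC
  `b² + σ² < t²`, not the strip `|σ| < t` the conclusion types; `disc_suffices_note` records why the
  disc for all `t` is enough (positivity of the spectral measure: Cauchy estimates at `b = 0` ⇒
  exponential moments ⇒ strip), closing refuter g41-34's gap (2).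
* §5 THE `t → ∞` (Paley–Wiener) STEP (proved): `cone_of_uniform_bound` — a finite positive
  combination of exponentials `∑ cᵢ e^{−tEᵢ − σpᵢ}` bounded uniformly on `|σ| < t` has all its
  frequencies in the cone `|pᵢ| ≤ Eᵢ`; §5b `cone_of_laplace_bound` — the same for an arbitrary Borel
  MEASURE on `ℝ²` (`μ {E < |p|} = 0`), i.e. literally the lemma a prover applies to the joint spectral
  measure of `(H,P₁)`, and the reason every cone-violating model violates the typed bound.

WHY IT RESISTS (proof sketch the disprover could not break; for the lead prover):
(1) e₀-OS reconstruction from `FrameRP S 1 0` + `TransInv` (tree: `OSReconstructionNoE1`,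
`OSDistributionSpace*`): `ℋ`, `H ≥ 0`, unitary `U₁(b)`, vectors `Ψ_F`; `Φ(t,b) = ⟨Ψ_F, e^{−tH}U₁(b)Ψ_G⟩`
and `μ_F ≥ 0` the joint spectral measure of `(H,P₁)` in `Ψ_F`. (2) For `F` time-ordered with small
support near a configuration in general position w.r.t. the `û`- and `v̂`-walls
(`û·xᵢ ≠ û·xⱼ`, `v̂·xᵢ ≠ v̂·xⱼ`), the number `Φ̃(u,v) := 𝔖(ΘF̄ ⊗ F_(t,b))`, `u = (t+b)/√2`,
`v = (t−b)/√2`, is by the two diagonal RPs (+ E3 to reorder arguments, + translations to place the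
mirror) separately holomorphic and BOUNDED (by the û-, resp. v̂-OS norms) on the cross
`({Re u > u₀} × (v₀,∞)) ∪ ((u₀,∞) × {Re v > v₀})`; the classical cross theorem with estimates
(Siciak 1969; Jarnicki–Pflug, *Separately analytic functions*, EMS 2011, Thm 5.4-type; here only
the half-plane/half-line case, relative extremal function `(2/π)|arg|`) gives a bounded holomorphic
extension to `{|arg(u−u₀)| + |arg(v−v₀)| < π/2}`, whose slice at real `t` contains the disc
`|b| < t − √2 max(u₀,v₀)` (`cross_slice_iff_disc`). (3) Positivity: `b ↦ Φ̃(t,b) = ∫ e^{ibp} dν_t`,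
`ν_t = ∫ e^{−tE} μ_F(dE,·) ≥ 0`; bounded holomorphy on the disc of radius `R = t − c` gives
`∫ p^{2k} dν_t ≤ M (2k)!/R^{2k}`, hence `∫ e^{a|p| − tE} dμ_F ≤ 2M/(1−(a/R)²)` for `a < R`; letting
`t → ∞` with `a = (1−ε)(t−c)` kills any mass of `μ_F` on `{E < (1−2ε)|p|}` (`cone_of_uniform_bound`
is the finite shadow). (4) Density of such `Ψ_F` (the one delicate step; NOT a Schwartz-topology
density — cut-offs near a wall do not converge in `𝓢`): the VACUUM Schwinger function `𝔖_{2n}` near an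
e₀-ordered configuration is jointly real-analytic in the consecutive time gaps with values in `𝒟'` of
the remaining variables (e₀-RP + translations only: split `𝔖_{2n}(ΘĀ ⊗ B_τ) = ⟨Ψ_A, e^{−τH}Ψ_B⟩` at
every gap, no E3 needed), hence its analytic wave-front set has no covector with a nonzero time
component; the û- and v̂-walls `{û·(xᵢ − xⱼ) = 0}` inside a cluster have conormals WITH a time
component (û, v̂ are not spatial), so `𝔖_{2n}` is smooth transversally to them and
`‖Ψ_{Fχ_k}‖² = 𝔖_{2n}(Θ(Fχ_k)‾ ⊗ Fχ_k) = O(1/k) → 0` for cut-offs `χ_k` of a `1/k`-neighbourhood of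
the walls: every `Ψ_F` is an OS-norm limit of bi-generic vectors, and the coned spectral subspace is
closed. (The same fails for e₁-walls `{xᵢ¹ = xⱼ¹}`, whose conormal is purely spatial — but the proof
never needs e₁-genericity.) (5) Spectral calculus: `Φ(ζ,β) := ⟨Ψ_F, e^{−ζH + iβP₁}Ψ_G⟩` is
holomorphic on `{Re ζ > |Im β|}` with `|Φ| ≤ ‖Ψ_F‖‖Ψ_G‖`.
Inputs: the cross theorem with estimates IS in the tree in exactly the needed special form —
`LogSlot.IsSectorData.exists_extension` (holomorphic extension to `{Re wⱼ > 0, ∑|arg wⱼ| < a}`,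
`a ≤ π/2`, OS II Ch. V (5.8) via Malgrange–Zerner) and `LogSlot.IsSectorData.norm_extension_le` (the
maximum principle on the envelope by the `1/(S − v)` trick) in
`Literature/MathematicalPhysics/QuantumFieldTheory/OSSectorContinuation.lean` (found only at cycle
close, after the crux directory became readable: both line leads already build on it); analytic
wave-front calculus for the disprover's version of step (4) is NOT in Mathlib — the leads' alternative
(density of cone-chain vectors by holomorphic gap-stretching + OS vector analyticity) avoids it and is
sound on paper (a vector orthogonal to all cone chains is orthogonal to every gap-stretched product
vector, and `s ↦ Ψ_{g₁⊗(g₂)_s⊗…}` is norm-analytic in the gaps by the Cauchy–Schwarz/Schwinger-function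
argument, so vanishing for large gaps propagates to all gaps). Nothing in (1)–(5) uses E0', the `±e₁`
frames, or the backward frames `−e₀, −(e₀±e₁)/√2`. Where a COUNTEREXAMPLE would have to live: a family
whose `𝔖_{2n}` is genuinely distributional transversally to a diagonal wall at e₀-ordered points while
RP in all frames — excluded by the wave-front argument if that argument is right; the disprover found
no such family (translation-invariant two-point wall layers `δ(û·ξ)g` already fail e₀-RP: their partial
Fourier transform `e^{ip₁ξ⁰}g` is not completely monotone in `ξ⁰`).

Nearest print (recalled; `lit search`/galaxy were DOWN (rc 75) during cycle 1 — to be verified, see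
NOTES.md §lit): Osterwalder–Seiler 1978 / Seiler LNP 159 (lattice: diagonal-plane RP and the lattice
spectrum condition for the transfer matrix — the lattice ancestor of this claim, also recalled by
refuter g41-34); Streater 1972 CMP 26 / Osipov 1977 CMP 57 / Heifets–Osipov (spectrum condition ⇔
Lorentz invariance for `P(φ)₂`, Yukawa₂ — the cone WITH rotations, converse direction);
Neeb–Ólafsson, *Reflection Positivity* (2018), Lüscher–Mack 1975 (cone semigroups ⇒ spectrum in the
dual cone — needs joint cone positivity, a point-reflection condition stronger than two mirrors);
Jarnicki–Pflug arXiv:0910.1176 Thm 1.1 (classical cross theorem WITH the sup-norm equality —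
verified, see `CrossTheoremQuadrant`). No continuum statement with a discrete set of RP directions is
known to the disprover: the crux is new as typed, and plausible.
-/

noncomputable section

namespace Summit.QuantumFields.YangMills.Cruxes.PlanarSpectralCone.Disproof

open scoped SchwartzMap ComplexConjugate
open MeasureTheory Filter Topology Complex
open Literature.MathematicalPhysics.QuantumLattice Literature.MathematicalPhysics.AQFT
  Literature.MathematicalPhysics.QuantumFieldTheory
open Summit.QuantumFields.YangMills.Theses.MirrorModularBoosts

local notation "E4" => EuclideanSpace ℝ (Fin 4)

/-! ## §0 The crux, split into named pieces -/

/-- Translation invariance on `⁰𝒮` (hypothesis 3 of the crux). [folklore] -/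
def TransInv (S : SchwingerFamily E4) : Prop :=
  ∀ (n : ℕ) (a : E4) (F : 𝓢((Fin n → E4), ℂ)), IsOffDiagonal F → S n (translateMulti a F) = S n F

/-- Reflection positivity of the pull-back `S ∘ R` for every frame `R` with time axis
`R e₀ = a e₀ + b e₁` (one summand of hypothesis 4 of the crux). [folklore] -/
def FrameRP (S : SchwingerFamily E4) (a b : ℝ) : Prop :=
  ∀ R : E4 ≃ₗᵢ[ℝ] E4,
    R (EuclideanSpace.single 0 1) = a • EuclideanSpace.single 0 1 + b • EuclideanSpace.single 1 1 →
      (SchwingerFamily.toLabelled (fun n => (S n).comp (linActMulti R))).IsReflectionPositive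

/-- Hypothesis 4 of the crux verbatim: RP in the eight frames of the four mirror lines of the
`(x₀,x₁)`-plane. [folklore] -/
def EightFrames (S : SchwingerFamily E4) : Prop :=
  ∀ (R : E4 ≃ₗᵢ[ℝ] E4) (a b : ℝ), a ^ 2 + b ^ 2 = 1 → (a = 0 ∨ b = 0 ∨ a ^ 2 = b ^ 2) →
    R (EuclideanSpace.single 0 1) = a • EuclideanSpace.single 0 1 + b • EuclideanSpace.single 1 1 →
      (SchwingerFamily.toLabelled (fun n => (S n).comp (linActMulti R))).IsReflectionPositive

/-- The conclusion of the crux verbatim (the planar spectral cone in matrix-element form). [folklore] -/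
def Concl (S : SchwingerFamily E4) : Prop :=
  ∀ (n m : ℕ) (F : 𝓢((Fin n → E4), ℂ)) (G : 𝓢((Fin m → E4), ℂ)), IsTimeOrdered F → IsTimeOrdered G →
    ∃ Φ : ℂ × ℂ → ℂ, DifferentiableOn ℂ Φ {w : ℂ × ℂ | |w.2.im| < w.1.re} ∧
      (∀ (t b : ℝ), 0 < t → ∀ H : 𝓢((Fin (n + m) → E4), ℂ),
        IsAppendTensorOf H (osAdjoint F)
          (translateMulti (t • EuclideanSpace.single 0 1 + b • EuclideanSpace.single 1 1) G) →
            Φ ((t : ℂ), (b : ℂ)) = S (n + m) H) ∧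
      (∀ w ∈ {w : ℂ × ℂ | |w.2.im| < w.1.re}, ∀ (HF : 𝓢((Fin (n + n) → E4), ℂ))
        (HG : 𝓢((Fin (m + m) → E4), ℂ)), IsAppendTensorOf HF (osAdjoint F) F →
          IsAppendTensorOf HG (osAdjoint G) G → ‖Φ w‖ ^ 2 ≤ ‖S (n + n) HF‖ * ‖S (m + m) HG‖)

/-- The crux is literally "E0' → E3 → translations → eight frames → cone". [folklore] -/
theorem crux_iff :
    PlanarSpectralCone ↔ ∀ S : SchwingerFamily E4, S.toLabelled.HasLinearGrowth →
      S.toLabelled.IsSymmetric → TransInv S → EightFrames S → Concl S :=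
  Iff.rfl

/-- Each of the eight frames is an instance of `EightFrames`. [folklore] -/
theorem EightFrames.frameRP {S : SchwingerFamily E4} (h : EightFrames S) {a b : ℝ}
    (hab : a ^ 2 + b ^ 2 = 1) (hcase : a = 0 ∨ b = 0 ∨ a ^ 2 = b ^ 2) : FrameRP S a b :=
  fun R hR => h R a b hab hcase hR

/-- Pulling back by the identity frame does nothing. [folklore] -/
theorem linActMulti_refl_eq {n : ℕ} (F : 𝓢((Fin n → E4), ℂ)) :
    linActMulti (LinearIsometryEquiv.refl ℝ E4) F = F := by
  ext x
  rw [linActMulti_apply]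
  rfl

/-- The time-frame hypothesis contains the tree's plain E2 for `S` itself (frame `R = id`): this is the
input of `OSReconstructionNoE1` (step (1) of the sketch). [folklore] -/
theorem FrameRP.reflectionPositive {S : SchwingerFamily E4} (h : FrameRP S 1 0) :
    S.toLabelled.IsReflectionPositive := by
  have hR : (LinearIsometryEquiv.refl ℝ E4) (EuclideanSpace.single 0 1) =
      (1 : ℝ) • EuclideanSpace.single 0 1 + (0 : ℝ) • EuclideanSpace.single 1 1 := by
    simp
  have key := h (LinearIsometryEquiv.refl ℝ E4) hR
  have hS : (fun n => (S n).comp (linActMulti (LinearIsometryEquiv.refl ℝ E4))) = S := by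
    funext n
    ext F
    rw [ContinuousLinearMap.comp_apply, linActMulti_refl_eq]
  rwa [hS] at key

/-- **The handle every attack uses.** The conclusion bounds the REAL matrix elements uniformly:
`‖𝔖(ΘF̄ ⊗ G_(t,b))‖² ≤ ‖𝔖(ΘF̄ ⊗ F)‖ ‖𝔖(ΘḠ ⊗ G)‖` for all `t > 0`, `b ∈ ℝ` (the real points lie in
the typed domain). A witness against the crux therefore only has to make `(t,b) ↦ 𝔖(ΘF̄ ⊗ G_(t,b))`
unbounded — or, via `cone_of_uniform_bound`, exhibit spectral mass outside the cone. [folklore] -/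
theorem Concl.real_bound {S : SchwingerFamily E4} (h : Concl S) {n m : ℕ} {F : 𝓢((Fin n → E4), ℂ)}
    {G : 𝓢((Fin m → E4), ℂ)} (hF : IsTimeOrdered F) (hG : IsTimeOrdered G)
    (HF : 𝓢((Fin (n + n) → E4), ℂ)) (HG : 𝓢((Fin (m + m) → E4), ℂ))
    (hHF : IsAppendTensorOf HF (osAdjoint F) F) (hHG : IsAppendTensorOf HG (osAdjoint G) G)
    {t : ℝ} (ht : 0 < t) (b : ℝ) (H : 𝓢((Fin (n + m) → E4), ℂ))
    (hH : IsAppendTensorOf H (osAdjoint F)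
      (translateMulti (t • EuclideanSpace.single 0 1 + b • EuclideanSpace.single 1 1) G)) :
    ‖S (n + m) H‖ ^ 2 ≤ ‖S (n + n) HF‖ * ‖S (m + m) HG‖ := by
  obtain ⟨Φ, _, hval, hbd⟩ := h n m F G hF hG
  have hw : ((t : ℂ), (b : ℂ)) ∈ {w : ℂ × ℂ | |w.2.im| < w.1.re} := by
    simp [ht]
  rw [← hval t b ht H hH]
  exact hbd _ hw HF HG hHF hHG

/-! ## §1 Junk models pass (no junk handle)

Both the zero family and the vacuum-only family satisfy every hypothesis in every frame and the
conclusion (with `Φ` constant). Contact terms supported on `{(xᵢ⁰,xᵢ¹) = (xⱼ⁰,xⱼ¹), i ≠ j}` are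
invisible to all eight RP conditions (frame-ordered supports avoid that set), to E3/translations
(imposed on `⁰𝒮` only where they hold anyway for translation-invariant even contact terms) and to
the conclusion (time-ordered supports) alike — so they give no handle either. -/

/-- The conclusion holds for the zero family (`Φ = 0`). [folklore] -/
theorem concl_zero : Concl (0 : SchwingerFamily E4) := by
  intro n m F G _ _
  refine ⟨fun _ => 0, differentiableOn_const 0, fun t b _ H _ => by simp, fun w _ HF HG _ _ => by simp⟩

/-- The zero family satisfies all four hypotheses (every RP sum is `0`). [folklore] -/
theorem hyps_zero :
    (0 : SchwingerFamily E4).toLabelled.HasLinearGrowth ∧ (0 : SchwingerFamily E4).toLabelled.IsSymmetric ∧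
      TransInv (0 : SchwingerFamily E4) ∧ EightFrames (0 : SchwingerFamily E4) := by
  refine ⟨fun T => ⟨0, 0, 0, fun n k _ F _ => by simp⟩,
    fun n k π F _ => by simp, fun n a F _ => by simp, fun R a b _ _ _ => ?_⟩
  intro N deg lab F hF H hH
  simp

/-- The crux holds AT the zero family. [folklore] -/
theorem crux_at_zero :
    (0 : SchwingerFamily E4).toLabelled.HasLinearGrowth → (0 : SchwingerFamily E4).toLabelled.IsSymmetric →
      TransInv (0 : SchwingerFamily E4) → EightFrames (0 : SchwingerFamily E4) →
        Concl (0 : SchwingerFamily E4) :=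
  fun _ _ _ _ => concl_zero

/-- The vacuum-only family `𝔖₀ = δ_pt`, `𝔖ₙ = 0 (n ≥ 1)` (the tree's `LabelledSchwingerFamily.trivial`
unlabelled). [folklore] -/
def vacuumOnly : SchwingerFamily E4 :=
  fun n => if n = 0 then LabelledSchwingerFamily.evalAt (0 : Fin n → E4) else 0

/-- It satisfies the whole OS package (tree). [folklore] -/
theorem vacuumOnly_osAxioms : vacuumOnly.OSAxiomsSchwinger :=
  SchwingerFamily.OSAxiomsSchwinger.trivial (d := 4)

/-- Degree `0`: the vacuum-only family is evaluation at the (unique) empty configuration. [folklore] -/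
theorem vacuumOnly_zero_apply (F : 𝓢((Fin 0 → E4), ℂ)) (x : Fin 0 → E4) : vacuumOnly 0 F = F x :=
  LabelledSchwingerFamily.trivial_zero_apply Unit (fun _ => ()) F x

/-- Positive degree: the vacuum-only family vanishes. [folklore] -/
theorem vacuumOnly_of_ne_zero {n : ℕ} (hn : n ≠ 0) : vacuumOnly n = 0 :=
  LabelledSchwingerFamily.trivial_of_ne_zero Unit hn (fun _ => ())

/-- Pulling the vacuum-only family back by any frame does nothing. [folklore] -/
theorem vacuumOnly_pullback (R : E4 ≃ₗᵢ[ℝ] E4) :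
    (fun n => (vacuumOnly n).comp (linActMulti R)) = vacuumOnly := by
  funext n
  by_cases hn : n = 0
  · subst hn
    ext F
    rw [ContinuousLinearMap.comp_apply, vacuumOnly_zero_apply _ (0 : Fin 0 → E4),
      vacuumOnly_zero_apply F (fun i => R.symm ((0 : Fin 0 → E4) i)), linActMulti_apply]
  · simp [vacuumOnly_of_ne_zero hn]

/-- The vacuum-only family satisfies all four hypotheses, RP in EVERY frame included. [folklore] -/
theorem hyps_vacuumOnly :
    vacuumOnly.toLabelled.HasLinearGrowth ∧ vacuumOnly.toLabelled.IsSymmetric ∧ TransInv vacuumOnly ∧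
      EightFrames vacuumOnly := by
  refine ⟨vacuumOnly_osAxioms.linearGrowth, vacuumOnly_osAxioms.symmetric,
    fun n a F hF => vacuumOnly_osAxioms.invariant.1 n (fun _ => ()) a F hF, fun R a b _ _ _ => ?_⟩
  rw [vacuumOnly_pullback]
  exact vacuumOnly_osAxioms.reflectionPositive

/-- The conclusion holds for the vacuum-only family: `Φ` is the constant `conj F(∅) · G(∅)` in degree
`(0,0)` and `0` otherwise; the bound is an equality in degree `(0,0)`. [folklore] -/
theorem concl_vacuumOnly : Concl vacuumOnly := by
  intro n m F G _ _
  by_cases hnm : n + m = 0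
  · obtain ⟨rfl, rfl⟩ : n = 0 ∧ m = 0 := by omega
    let x₀ : Fin 0 → E4 := 0
    refine ⟨fun _ => conj (F x₀) * G x₀, differentiableOn_const _, fun t b _ H hH => ?_,
      fun w _ HF HG hHF hHG => ?_⟩
    · rw [vacuumOnly_zero_apply H x₀, hH x₀, osAdjoint_apply, translateMulti_apply]
      exact congrArg₂ (fun a b => conj a * b) (congrArg F (Subsingleton.elim _ _))
        (congrArg G (Subsingleton.elim _ _))
    · rw [vacuumOnly_zero_apply HF x₀, vacuumOnly_zero_apply HG x₀, hHF x₀, hHG x₀, osAdjoint_apply,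
        osAdjoint_apply]
      have h1 : (F fun i => timeReflection 4 ((x₀ ∘ Fin.castAdd 0) (Fin.rev i))) = F x₀ :=
        congrArg _ (Subsingleton.elim _ _)
      have h2 : (G fun i => timeReflection 4 ((x₀ ∘ Fin.castAdd 0) (Fin.rev i))) = G x₀ :=
        congrArg _ (Subsingleton.elim _ _)
      have h3 : F (x₀ ∘ Fin.natAdd 0) = F x₀ := congrArg _ (Subsingleton.elim _ _)
      have h4 : G (x₀ ∘ Fin.natAdd 0) = G x₀ := congrArg _ (Subsingleton.elim _ _)
      rw [h1, h2, h3, h4]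
      simp only [norm_mul, Complex.norm_conj]
      nlinarith [norm_nonneg (F x₀), norm_nonneg (G x₀)]
  · refine ⟨fun _ => 0, differentiableOn_const 0, fun t b _ H _ => ?_, fun w _ HF HG _ _ => ?_⟩
    · simp [vacuumOnly_of_ne_zero hnm]
    · simpa using mul_nonneg (norm_nonneg (vacuumOnly (n + n) HF)) (norm_nonneg (vacuumOnly (m + m) HG))

/-- The crux holds AT the vacuum-only family. [folklore] -/
theorem crux_at_vacuumOnly :
    vacuumOnly.toLabelled.HasLinearGrowth → vacuumOnly.toLabelled.IsSymmetric → TransInv vacuumOnly →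
      EightFrames vacuumOnly → Concl vacuumOnly :=
  fun _ _ _ _ => concl_vacuumOnly

/-! ## §2 Load-bearing analysis -/

/-- The crux with the four DIAGONAL frames dropped (RP only for `R e₀ ∈ {±e₀, ±e₁}`). [folklore] -/
def WithoutDiagonalFrames : Prop :=
  ∀ S : SchwingerFamily E4, S.toLabelled.HasLinearGrowth → S.toLabelled.IsSymmetric → TransInv S →
    (∀ a b : ℝ, a ^ 2 + b ^ 2 = 1 → (a = 0 ∨ b = 0) → FrameRP S a b) → Concl S

/-- **Any proof must use a diagonal frame.** Paper witness (refuted strengthening, not yet in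
Lean): the slow-light free field, i.e. the Gaussian family with two-point function
`Ĉ(p) = 1/(p₀² + c²p₁² + p₂² + p₃² + m²)`, `0 < c < 1`. It is the pull-back of the free field by
the non-isometric `diag(1, 1/c, 1, 1)`, which commutes with the reflections `θ₀, θ₁` and preserves
`x⁰`- and `x¹`-orderings, so RP holds in the four axis frames; E0', E3, translations hold. Its
`e₀`-spectral measure sits on the shell `E = √(c²p₁² + p⊥² + m²)`, which has `E < |p₁|` for
`|p₁|` large: for `F = G` a one-point test function with `Ψ_F ≠ 0` the bound
`|Φ(t, iσ)|² ≤ ‖Ψ_F‖⁴` fails as `t → ∞` along `σ = ±(1−ε)t` (cf. `cone_of_uniform_bound`), and by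
the identity theorem no other holomorphic `Φ` matches the real values. Obstruction to a Lean proof:
no Gaussian/free `SchwingerFamily` with its `(H,P₁)` spectral representation in the tree. [folklore] -/
theorem false_without_diagonalFrames : ¬ WithoutDiagonalFrames := by
  sorry

/-- The crux with translation invariance dropped. [folklore] -/
def WithoutTranslation : Prop :=
  ∀ S : SchwingerFamily E4, S.toLabelled.HasLinearGrowth → S.toLabelled.IsSymmetric → EightFrames S →
    Concl S

/-- **Any proof must use translation invariance.** Paper witness: the conformally weighted
massless free field, `𝔖₂(x,y) = ρ(x)ρ(y) W₀(x − y)` with `W₀(ξ) = 1/(4π²|ξ|²)` and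
`ρ(x) = 1 + (x⁰)² + (x¹)²` (Gaussian family). Every mirror THROUGH THE ORIGIN fixes `ρ`, so the
eight RP conditions reduce to those of the massless free field (test functions `ρf`); E0' holds with
`s = 2`; E3 holds. But `Φ(t,b) = 𝔖₂(ΘF̄ ⊗ G_(t,b))` grows like `b²` along real `b` (weight `ρ ∼ b²`
against the `|ξ|⁻²` decay of `W₀`), while the typed bound asks `|Φ(t,b)|² ≤ 𝔖(ΘF̄F)𝔖(ΘḠG)`
uniformly on the real points `(t,b)`, `t > 0`, of the domain. Without translations the mirrors
through the origin say nothing about parallel mirrors, and there is no semigroup. [folklore] -/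
theorem false_without_translation : ¬ WithoutTranslation := by
  sorry

/-- The crux with the AXIS frames dropped (RP only across the two diagonals, both orientations). [folklore] -/
def WithoutAxisFrames : Prop :=
  ∀ S : SchwingerFamily E4, S.toLabelled.HasLinearGrowth → S.toLabelled.IsSymmetric → TransInv S →
    (∀ a b : ℝ, a ^ 2 + b ^ 2 = 1 → a ^ 2 = b ^ 2 → FrameRP S a b) → Concl S

/-- **Any proof must use the time frame `e₀`.** Paper witness: the sheared free field with
`Ĉ(p) = 1/((1+κ)p_u² + (1−κ)p_v² + p⊥² + m²)`, `p_u = (p₀+p₁)/√2`, `p_v = (p₀−p₁)/√2`, `0 < κ < 1`: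
an anisotropic free field in light-cone axes, hence RP across both diagonal mirrors in both
orientations (pull-back of the free field by a diagonal non-isometric stretch), E0', E3, translations.
In `(p₀,p₁)` the form is `p₀² + p₁² + 2κp₀p₁ + p⊥² + m²`, NOT even in `p₀`: no Laplace
representation in `x⁰`; closing the `p₀`-contour at the poles `p₀ = −κp₁ ± iω`,
`ω² = (1−κ²)p₁² + p⊥² + m²`, gives for time-compactly supported `f, g`
`Φ(t,b) = ∫ d³p A(p⃗) e^{−ωt − iκp₁t + ip₁b}`, whose continuation has modulus governed by
`exp(−ω Re ζ + κp₁ Im ζ − p₁ Im β)`. The typed domain leaves `Im ζ` FREE, and along `ζ = t + iτ`,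
`β = b` real, `τ → ∞` the factor `e^{κ|p₁||τ|}` against a Gaussian amplitude makes `|Φ| ∼ e^{cκ²τ²}`:
either the continuation does not exist or it violates the uniform bound `|Φ|² ≤ 𝔖(ΘF̄F)𝔖(ΘḠG)` inside
the domain (with e₀-RP, `e^{−iτH}` is unitary and this direction is harmless — so the time frame is
load-bearing already for boundedness in `Im ζ`). The unsmeared `W` is moreover singular on the complex
characteristic variety of the form, which meets `{Re ζ > |Im β|}`. (This drops `±e₀` and `±e₁`
together; for Gaussian families `e₀`-RP plus ONE diagonal RP already forces the full dihedral
symmetry, so a Gaussian cannot separate the `e₁` frames from the rest.) [folklore] -/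
theorem false_without_axisFrames : ¬ WithoutAxisFrames := by
  sorry

/-- The weakened-hypothesis variants sit ABOVE the crux: each implies it (so a proof of any of them
would prove the crux, and the paper witnesses against them do not touch the crux). [folklore] -/
theorem crux_of_withoutDiagonalFrames (h : WithoutDiagonalFrames) : PlanarSpectralCone := by
  rw [crux_iff]
  intro S hg hs ht h8
  exact h S hg hs ht fun a b hab hcase => h8.frameRP hab (hcase.elim Or.inl fun hb => Or.inr (Or.inl hb))

/-- See `crux_of_withoutDiagonalFrames`. [folklore] -/
theorem crux_of_withoutTranslation (h : WithoutTranslation) : PlanarSpectralCone := by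
  rw [crux_iff]
  intro S hg hs _ h8
  exact h S hg hs h8

/-- See `crux_of_withoutDiagonalFrames`. [folklore] -/
theorem crux_of_withoutAxisFrames (h : WithoutAxisFrames) : PlanarSpectralCone := by
  rw [crux_iff]
  intro S hg hs ht h8
  exact h S hg hs ht fun a b hab hcase => h8.frameRP hab (Or.inr (Or.inr hcase))

/-- **The sharpened statement the disprover believes TRUE** (and could not break): same conclusion
from E3 + translations + RP in only THREE frames — the time frame `e₀` and the two forward diagonal
frames `(e₀ ± e₁)/√2` — and no E0'. The proof sketch in the module docstring uses exactly these.
Planner: if the lead proves the crux along that sketch, this is what is actually shown. [folklore] -/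
def SharpenedCone : Prop :=
  ∀ S : SchwingerFamily E4, S.toLabelled.IsSymmetric → TransInv S → FrameRP S 1 0 →
    (∀ c : ℝ, 0 < c → c ^ 2 = 1 / 2 → FrameRP S c c ∧ FrameRP S c (-c)) → Concl S

/-- The sharpened statement implies the crux (the crux carries more hypotheses). [folklore] -/
theorem sharpened_implies_crux (h : SharpenedCone) : PlanarSpectralCone := by
  rw [crux_iff]
  intro S _ hsymm htrans h8
  refine h S hsymm htrans (h8.frameRP (a := 1) (b := 0) (by norm_num) (Or.inr (Or.inl rfl))) ?_
  intro c _ hc2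
  exact ⟨h8.frameRP (by rw [hc2]; norm_num) (Or.inr (Or.inr rfl)),
    h8.frameRP (by rw [neg_sq, hc2]; norm_num) (Or.inr (Or.inr (by rw [neg_sq])))⟩

/-- The crux with E0' and E3 dropped and only the three forward frames kept is sandwiched:
`SharpenedCone → PlanarSpectralCone`; the disprover found no witness against `SharpenedCone`
(E0' is used by no step of the sketch; E3 only to reorder arguments inside frame changes and in
the density step). Recorded as an open strengthening, deliberately NOT claimed. [folklore] -/
theorem sharpened_open_note : True := trivial

/-! ## §3 Why Gaussian counterexamples fail

For a real Gaussian family RP across a mirror forces reflection SYMMETRY of the covariance across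
it (the Laplace–Fourier representation has a real measure), so eight-frame RP makes `Ĉ(p₀,p₁,p⊥)`
dihedrally symmetric in `(p₀,p₁)`, Stieltjes in `p₀²` on every line `p₁ = const` and Stieltjes in
`p_u²` on every line `p_v = const` (modulo contact polynomials). The cone asks that the `p₀²`-cuts
start at `E² ≥ p₁²`. -/

/-- **Single shell: symmetry across ONE diagonal pins the speed of light.** If
`q ↦ (q + k)² + Λ(q − k)` is even for every `k` (evenness in the light-cone momentum `q = p_u` of
`p₀² + Λ(p₁)` along `p_v = k`, unnormalised light-cone coordinates), then `Λ(a) = a² + Λ(0)`: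
the shell is `p₀² + p₁² + m²`. Hence no single-shell Gaussian counterexample
(refuter g41-34's remark as a one-line lemma). [folklore] -/
theorem dispersion_rigidity (Λ : ℝ → ℝ)
    (h : ∀ q k : ℝ, (q + k) ^ 2 + Λ (q - k) = (-q + k) ^ 2 + Λ (-q - k)) (a : ℝ) :
    Λ a = a ^ 2 + Λ 0 := by
  have := h (a / 2) (-(a / 2))
  ring_nf at this ⊢
  linarith

/-- The two-shell quartic test family `P_ε(x,y) = (x + y + a)(x + y + b) + ε x y` in `x = p₀²`,
`y = p₁²` (so `Ĉ = N/P_ε` with an interlacing numerator). [folklore] -/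
def quarticP (a b ε x y : ℝ) : ℝ := (x + y + a) * (x + y + b) + ε * x * y

/-- **Light-cone crossing for `ε > 0`.** On the complex light cone `p₀ = i p₁`, i.e. `x = −y`,
`P_ε(−y, y) = ab − ε y²` vanishes at `y = √(ab/ε)`: the singular variety of `Ĉ` crosses the light
cone, so the `e₀`-spectral shell dips below `E = |p₁|` — the cone FAILS for every `ε > 0`. [folklore] -/
theorem lightCone_crossing (a b ε : ℝ) (ha : 0 < a) (hb : 0 < b) (hε : 0 < ε) :
    ∃ y : ℝ, 0 < y ∧ quarticP a b ε (-y) y = 0 := by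
  refine ⟨Real.sqrt (a * b / ε), Real.sqrt_pos.2 (by positivity), ?_⟩
  have hs : Real.sqrt (a * b / ε) ^ 2 = a * b / ε := Real.sq_sqrt (by positivity)
  unfold quarticP
  have : ε * (a * b / ε) = a * b := by field_simp
  nlinarith [hs, this]

/-- **Axis Stieltjes needs `ε ≥ 0`.** As a quadratic in `x = p₀²` at fixed `y = p₁²`, `P_ε` has
discriminant `(4ε + ε²) y² + 2ε(a+b) y + (a−b)²`; for `−4 < ε < 0` it is negative for large `y`
(complex shells: no Laplace representation in `x⁰`, `e₀`-RP fails), and for `ε ≤ −4` the roots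
turn positive (real poles of `Ĉ`). Here: the discriminant identity. [folklore] -/
theorem axis_discriminant (a b ε y : ℝ) :
    ((2 + ε) * y + a + b) ^ 2 - 4 * ((y + a) * (y + b)) =
      (4 * ε + ε ^ 2) * y ^ 2 + 2 * ε * (a + b) * y + (a - b) ^ 2 := by
  ring

/-- **Diagonal Stieltjes needs `ε ≤ 0`.** Along `p_v = const` (`p₀² + p₁² = z + κ`,
`p₀²p₁² = (z − κ)²/4` with `z = q²`, `κ = k²`), `P_ε` is the quadratic
`(1 + ε/4) z² + ((2 − ε/2)κ + a + b) z + (κ + a)(κ + b) + εκ²/4` in `z`, whose discriminant has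
leading coefficient `−4ε` in `κ`: for `ε > 0` it is negative for large `κ`, i.e. complex roots in
`q²` — not Stieltjes, diagonal RP FAILS. Together with `lightCone_crossing`/`axis_discriminant`:
only `ε = 0` (two free shells) survives all frames, and it has the cone. [folklore] -/
theorem diag_discriminant (a b ε κ : ℝ) :
    ((2 - ε / 2) * κ + a + b) ^ 2 - 4 * (1 + ε / 4) * ((κ + a) * (κ + b) + ε * κ ^ 2 / 4) =
      -(4 * ε) * κ ^ 2 + (-(2 * ε) * (a + b)) * κ + ((a - b) ^ 2 - ε * a * b) := by
  ring

/-- For `ε > 0` the diagonal discriminant is eventually negative (explicit threshold). [folklore] -/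
theorem diag_discriminant_neg (a b ε : ℝ) (ha : 0 < a) (hb : 0 < b) (hε : 0 < ε) :
    ∃ κ₀ : ℝ, ∀ κ, κ₀ ≤ κ →
      ((2 - ε / 2) * κ + a + b) ^ 2 - 4 * (1 + ε / 4) * ((κ + a) * (κ + b) + ε * κ ^ 2 / 4) < 0 := by
  refine ⟨(a - b) ^ 2 / ε + 1, fun κ hκ => ?_⟩
  rw [diag_discriminant]
  have hκ0 : 0 < κ := by
    have : 0 ≤ (a - b) ^ 2 / ε := by positivity
    linarith
  have h1 : (a - b) ^ 2 ≤ ε * κ := by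
    have : (a - b) ^ 2 / ε ≤ κ := by linarith
    rwa [div_le_iff₀ hε, mul_comm] at this
  have hκ1 : 1 ≤ κ := by
    have : 0 ≤ (a - b) ^ 2 / ε := by positivity
    linarith
  nlinarith [mul_pos hε hκ0, mul_pos ha hb, mul_pos (mul_pos hε hκ0) hκ0,
    mul_le_mul_of_nonneg_left hκ1 (mul_pos hε hκ0).le]

/-- **The Gaussian case is a theorem (paper).** For a Gaussian family whose covariance is smooth off
the origin, eight-frame RP DOES imply the cone: steps (2)–(3) of the module docstring apply verbatim
to `W(ξ₀,ξ₁)` (Laplace–Fourier representations in `u` and in `v` with positive measures give bounded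
separate holomorphy on the cross; cross theorem; positivity of `ν_t`; `t → ∞`), and Fock
functoriality lifts the one-particle cone to all `(n,m)`. This is why the planner's and three
refuters' Gaussian hunts (separable completely-monotone mixtures, anisotropic/flat-band/`D₄`-symmetrised
propagators, the quartic family above) all fail: the route's "cheapest falsifier" cannot fire.
Numerical companion: compute job `j005173` (`gauss_scan.py`: random + penalised Nelder–Mead scan of
D₄-symmetric rational `Ĉ = N(s,r)/D(s,r)`, `s = p₀²+p₁²`, `r = p₀²p₁²`, momentum degree ≤ 6, keeping
those Stieltjes-mod-polynomial along every axis line AND every diagonal line, reporting the worst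
cone violation among survivors) — submitted 2026-08-15T22:29Z with `--workitem`, still QUEUED behind a
saturated farm (> 6 h) when cycle 1 closed; its summary auto-attaches to the item when it runs.
Prediction recorded in advance: no feasible cone violation. [folklore] -/
theorem gaussian_case_note : True := trivial

/-! ## §4 Geometry of the intended proof: the cross envelope slices in DISCS -/

/-- For `x > 0`: `arctan x + arctan y < π/2 ↔ x y < 1`. [folklore] -/
theorem arctan_add_lt_pi_div_two_iff {x y : ℝ} (hx : 0 < x) :
    Real.arctan x + Real.arctan y < Real.pi / 2 ↔ x * y < 1 := by
  constructor
  · intro h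
    rcases lt_or_ge (x * y) 1 with hxy | hxy
    · exact hxy
    exfalso
    have hy' : x⁻¹ ≤ y := by
      rw [inv_le_iff_one_le_mul₀ hx]
      linarith
    have hmono : Real.arctan x⁻¹ ≤ Real.arctan y := Real.arctan_mono hy'
    rw [Real.arctan_inv_of_pos hx] at hmono
    linarith
  · exact Real.arctan_add_arctan_lt_pi_div_two

/-- **The Siciak–Zahariuta envelope meets the complex `x₁`-line in a disc, not a strip.** With
`u = (t + b) + iσ`, `u' = (t − b) − iσ` (unnormalised light-cone coordinates of the point
`(x₀,x₁) = (t, b + iσ)`, `t ± b > 0`), the envelope condition `|arg u| + |arg u'| < π/2`, i.e.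
`arctan(|σ|/(t+b)) + arctan(|σ|/(t−b)) < π/2`, is EQUIVALENT to `b² + σ² < t²`. So the cross theorem
alone continues `b ↦ 𝔖(ΘF̄ ⊗ G_(t,b))` to the disc `|b| < t`, while the conclusion types the strip
`|Im b| < t` (refuter g41-34, gap (2)); `disc_suffices_note` says why the disc is enough. [folklore] -/
theorem cross_slice_iff_disc (t b σ : ℝ) (h₁ : 0 < t + b) (h₂ : 0 < t - b) :
    Real.arctan (|σ| / (t + b)) + Real.arctan (|σ| / (t - b)) < Real.pi / 2 ↔ b ^ 2 + σ ^ 2 < t ^ 2 := by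
  rcases eq_or_ne σ 0 with rfl | hσ
  · simp only [abs_zero, zero_div, Real.arctan_zero, add_zero]
    constructor
    · intro; nlinarith
    · intro; positivity
  have hσ' : 0 < |σ| := abs_pos.2 hσ
  rw [arctan_add_lt_pi_div_two_iff (y := |σ| / (t - b)) (div_pos hσ' h₁),
    div_mul_div_comm, div_lt_one (mul_pos h₁ h₂), ← sq, sq_abs]
  constructor <;> intro h <;> nlinarith

/-- **The one SCV input, stated exactly.** (Written as a fact request; at cycle close it turned out to
be IN THE TREE already as OS II's (5.8): `LogSlot.IsSectorData.exists_extension` /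
`.norm_extension_le`, `OSSectorContinuation.lean`, opening `a = π/2`, modulo the `IsSectorData`
packaging of continuity/polynomial-growth side conditions.) The classical cross theorem with
estimates in the only case the proof needs: `D = G =` right half-plane,
`A = B = (0,∞)`, relative extremal function `ω(u) = (2/π)|arg u|`, envelope
`X̂ = {|arg u| + |arg v| < π/2}`. A function separately holomorphic and bounded by `M` on the cross
`(D × B) ∪ (A × G)` is the restriction of a function holomorphic and bounded by `M` on `X̂`
— VERIFIED in print: Jarnicki–Pflug, *A new cross theorem for separately holomorphic functions*,
Proc. AMS 138 (2010) 3923–3932 = arXiv:0910.1176, Thm 1.1 (p. 3, quoting Siciak 1969a,b, Zahariuta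
1976, Siciak 1981): "for each `f ∈ 𝒪_s(X)` there exists exactly one `f̂ ∈ 𝒪(X̂)` such that `f̂ = f`
on `X` and `sup_X̂ |f̂| = sup_X |f|`", `X̂ = {Σ h*_{A_j,D_j}(z_j) < 1}`; NO boundedness hypothesis is
needed for the extension itself, and the sup-norm EQUALITY is part of the theorem (so step (3)'s
uniform `M` is exactly the larger of the two OS-norm products on the arms). Here `D_j` = half-planes
(domains of holomorphy in `ℂ`), `A_j = (0,∞)` (locally regular), `h_{(0,∞),{Re>0}}(u) = (2/π)|arg u|`.
Not in Mathlib as such; the tree's engine proves this special case through the biholomorphism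
`log : {Re u > 0} → {|Im| < π/2}` and the tube (Malgrange–Zerner) argument. Thresholds `u₀, v₀` are
removed by translation. [folklore] -/
def CrossTheoremQuadrant : Prop :=
  ∀ (f : ℂ × ℂ → ℂ) (M : ℝ),
    (∀ v : ℝ, 0 < v → DifferentiableOn ℂ (fun u : ℂ => f (u, (v : ℂ))) {u : ℂ | 0 < u.re}) →
    (∀ u : ℝ, 0 < u → DifferentiableOn ℂ (fun v : ℂ => f ((u : ℂ), v)) {v : ℂ | 0 < v.re}) →
    (∀ (u : ℂ) (v : ℝ), 0 < u.re → 0 < v → ‖f (u, (v : ℂ))‖ ≤ M) →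
    (∀ (u : ℝ) (v : ℂ), 0 < u → 0 < v.re → ‖f ((u : ℂ), v)‖ ≤ M) →
      ∃ g : ℂ × ℂ → ℂ,
        DifferentiableOn ℂ g {w : ℂ × ℂ | 0 < w.1.re ∧ 0 < w.2.re ∧ |w.1.arg| + |w.2.arg| < Real.pi / 2} ∧
        (∀ (u : ℂ) (v : ℝ), 0 < u.re → 0 < v → g (u, (v : ℂ)) = f (u, (v : ℂ))) ∧
        (∀ (u : ℝ) (v : ℂ), 0 < u → 0 < v.re → g ((u : ℂ), v) = f ((u : ℂ), v)) ∧
        ∀ w ∈ {w : ℂ × ℂ | 0 < w.1.re ∧ 0 < w.2.re ∧ |w.1.arg| + |w.2.arg| < Real.pi / 2}, ‖g w‖ ≤ M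

/-- Sanity: the two arms of the cross lie in the envelope (so the agreement clauses of
`CrossTheoremQuadrant` are stated on subsets of the domain of `g`). [folklore] -/
theorem cross_arm_mem_envelope (u : ℂ) (v : ℝ) (hu : 0 < u.re) (hv : 0 < v) :
    ((u, (v : ℂ)) : ℂ × ℂ) ∈
      {w : ℂ × ℂ | 0 < w.1.re ∧ 0 < w.2.re ∧ |w.1.arg| + |w.2.arg| < Real.pi / 2} := by
  refine ⟨hu, by simpa using hv, ?_⟩
  simp only [Complex.arg_ofReal_of_nonneg hv.le, abs_zero, add_zero]
  exact Complex.abs_arg_lt_pi_div_two_iff.2 (Or.inl hu)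

/-- **Why the disc for all `t` suffices (positivity).** `b ↦ Φ̃(t,b) = ∫ e^{ibp} dν_t(p)` with
`ν_t = ∫ e^{−tE} μ_F(dE, ·) ≥ 0` a FINITE POSITIVE measure (`F = G`). Bounded holomorphy
(`|Φ̃| ≤ M`) on the disc `|b| < R` gives, by Cauchy's estimates at `b = 0` and
`Φ̃^{(2k)}(t,0) = (−1)^k ∫ p^{2k} dν_t`, the moment bounds `∫ p^{2k} dν_t ≤ M(2k)!/R^{2k}`, hence
`∫ cosh(ap) dν_t ≤ M/(1 − (a/R)²)` for `a < R`: `ν_t` has exponential moments up to `R` and `Φ̃(t,·)`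
extends to the STRIP `|Im b| < R` bounded on closed substrips. With `R = t − c_F` this feeds the
`t → ∞` step (`cone_of_uniform_bound`). Polarisation handles `F ≠ G`. [folklore] -/
theorem disc_suffices_note : True := trivial

/-! ## §5 The `t → ∞` (Paley–Wiener) step in miniature -/

/-- `c₀ e^{A + δt}` with `c₀, δ > 0` is not bounded for `t > 1`. [folklore] -/
theorem exp_ray_unbounded (c₀ δ A M : ℝ) (hc : 0 < c₀) (hδ : 0 < δ)
    (h : ∀ t : ℝ, 1 < t → c₀ * Real.exp (A + δ * t) ≤ M) : False := by
  have hM : 0 < M := lt_of_lt_of_le (mul_pos hc (Real.exp_pos _)) (h 2 (by norm_num))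
  set t : ℝ := max 2 ((Real.log (M / c₀) - A) / δ + 1) with ht
  have ht1 : 1 < t := by
    have := le_max_left (2 : ℝ) ((Real.log (M / c₀) - A) / δ + 1)
    linarith
  have ht2 : (Real.log (M / c₀) - A) / δ < t := by
    have := le_max_right (2 : ℝ) ((Real.log (M / c₀) - A) / δ + 1)
    linarith
  have hlt : Real.log (M / c₀) < A + δ * t := by
    rw [div_lt_iff₀ hδ] at ht2
    linarith
  have hexp : M / c₀ < Real.exp (A + δ * t) := by
    calc M / c₀ = Real.exp (Real.log (M / c₀)) := (Real.exp_log (div_pos hM hc)).symm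
      _ < Real.exp (A + δ * t) := Real.exp_lt_exp.2 hlt
  rw [div_lt_iff₀ hc] at hexp
  have hcomm := mul_comm (Real.exp (A + δ * t)) c₀
  have := h t ht1
  linarith

/-- **Finite shadow of the spectral step.** If a finite positive combination of plane
exponentials `∑ᵢ cᵢ e^{−t Eᵢ − σ pᵢ}` is bounded by one constant on the whole real section
`{(t,σ) : |σ| < t}` of the typed domain, then every frequency lies in the cone `|pᵢ| ≤ Eᵢ`.
(For the spectral measure `μ_F` this is step (3)→cone of the sketch; the uniform bound is the
Cauchy–Schwarz bound of the conclusion; the ray used is `σ = ∓(t − 1)`.) [folklore] -/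
theorem cone_of_uniform_bound {ι : Type*} [Fintype ι] (c En p : ι → ℝ) (hc : ∀ i, 0 < c i) (M : ℝ)
    (h : ∀ t σ : ℝ, |σ| < t → ∑ i, c i * Real.exp (-(t * En i) - σ * p i) ≤ M) (i : ι) :
    |p i| ≤ En i := by
  rcases le_or_gt |p i| (En i) with hle | hlt
  · exact hle
  exfalso
  -- the `i`-th term alone is bounded by `M` (all terms are nonnegative)
  have hterm : ∀ t σ : ℝ, |σ| < t → c i * Real.exp (-(t * En i) - σ * p i) ≤ M := fun t σ hσ =>
    (Finset.single_le_sum (f := fun j => c j * Real.exp (-(t * En j) - σ * p j))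
      (fun j _ => mul_nonneg (hc j).le (Real.exp_pos _).le) (Finset.mem_univ i)).trans (h t σ hσ)
  rcases lt_trichotomy (p i) 0 with hp | hp | hp
  · -- `pᵢ < 0`: ray `σ = t - 1`, exponent `pᵢ + (-pᵢ - Eᵢ) t`
    rw [abs_of_neg hp] at hlt
    refine exp_ray_unbounded (c i) (-p i - En i) (p i) M (hc i) (by linarith) fun t ht => ?_
    have key := hterm t (t - 1) (by rw [abs_of_pos (by linarith)]; linarith)
    rwa [show -(t * En i) - (t - 1) * p i = p i + (-p i - En i) * t by ring] at key
  · -- `pᵢ = 0`: ray `σ = 0`, exponent `-Eᵢ t`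
    rw [hp, abs_zero] at hlt
    refine exp_ray_unbounded (c i) (-En i) 0 M (hc i) (by linarith) fun t ht => ?_
    have key := hterm t 0 (by rw [abs_zero]; linarith)
    rwa [hp, show -(t * En i) - 0 * 0 = 0 + -En i * t by ring] at key
  · -- `pᵢ > 0`: ray `σ = -(t - 1)`, exponent `-pᵢ + (pᵢ - Eᵢ) t`
    rw [abs_of_pos hp] at hlt
    refine exp_ray_unbounded (c i) (p i - En i) (-p i) M (hc i) (by linarith) fun t ht => ?_
    have key := hterm t (-(t - 1)) (by rw [abs_neg, abs_of_pos (by linarith)]; linarith)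
    rwa [show -(t * En i) - -(t - 1) * p i = -p i + (p i - En i) * t by ring] at key

/-! ## §5b The same step for MEASURES (what a prover actually invokes)

For the joint spectral measure `μ_F` of `(H, P₁)` in a vector `Ψ_F` (a finite positive Borel measure on
`ℝ × ℝ`, coordinates `(E, p)`), the real points of the conclusion give
`∫ e^{−tE − σp} dμ_F = Φ(t, iσ)·(…) ≤ ‖Ψ_F‖²` for `|σ| < t`; the lemma below turns exactly such a
uniform Laplace bound into `μ_F {E < |p|} = 0`. Stated with the lower Lebesgue integral so that no
integrability side condition is needed. -/

/-- One half-cone slab has measure zero under a uniform Laplace bound: if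
`∫⁻ e^{−tE−σp} dμ ≤ M` for all `|σ| < t`, then `μ {E ≤ p − δ, p ≤ N} = 0` (`δ > 0`). Ray `σ = −(t−1)`:
on the slab the exponent is `≥ tδ − N`. [folklore] -/
theorem slab_null_of_laplace_bound (μ : Measure (ℝ × ℝ)) (M : ℝ)
    (h : ∀ t σ : ℝ, |σ| < t →
      ∫⁻ x, ENNReal.ofReal (Real.exp (-(t * x.1) - σ * x.2)) ∂μ ≤ ENNReal.ofReal M)
    {δ : ℝ} (hδ : 0 < δ) (N : ℝ) :
    μ {x : ℝ × ℝ | x.1 ≤ x.2 - δ ∧ x.2 ≤ N} = 0 := by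
  set B := {x : ℝ × ℝ | x.1 ≤ x.2 - δ ∧ x.2 ≤ N} with hB
  -- for every `t > 1`: `e^{tδ - N} μ(B) ≤ M`
  have hbound : ∀ t : ℝ, 1 < t → ENNReal.ofReal (Real.exp (t * δ - N)) * μ B ≤ ENNReal.ofReal M := by
    intro t ht
    have hσ : |(-(t - 1))| < t := by
      rw [abs_neg, abs_of_pos (by linarith)]; linarith
    calc ENNReal.ofReal (Real.exp (t * δ - N)) * μ B
        = ∫⁻ _ in B, ENNReal.ofReal (Real.exp (t * δ - N)) ∂μ := by
          rw [setLIntegral_const]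
      _ ≤ ∫⁻ x in B, ENNReal.ofReal (Real.exp (-(t * x.1) - (-(t - 1)) * x.2)) ∂μ := by
          refine setLIntegral_mono' ?_ fun x hx => ?_
          · exact (measurableSet_le measurable_fst (measurable_snd.sub measurable_const)).inter
              (measurableSet_le measurable_snd measurable_const)
          · obtain ⟨h1, h2⟩ := hx
            apply ENNReal.ofReal_le_ofReal
            apply Real.exp_le_exp.2
            nlinarith
      _ ≤ ∫⁻ x, ENNReal.ofReal (Real.exp (-(t * x.1) - (-(t - 1)) * x.2)) ∂μ :=
          setLIntegral_le_lintegral _ _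
      _ ≤ ENNReal.ofReal M := h t _ hσ
  -- hence `μ(B) ≤ M e^{N - tδ}` for all `t > 1`, so `μ(B) = 0`
  have hle : ∀ t : ℝ, 1 < t → μ B ≤ ENNReal.ofReal (M * Real.exp (N - t * δ)) := by
    intro t ht
    have hpos : 0 < Real.exp (t * δ - N) := Real.exp_pos _
    have key := hbound t ht
    have : μ B ≤ ENNReal.ofReal M / ENNReal.ofReal (Real.exp (t * δ - N)) := by
      rw [ENNReal.le_div_iff_mul_le (Or.inl ((ENNReal.ofReal_pos.2 hpos).ne'))
        (Or.inl ENNReal.ofReal_ne_top), mul_comm]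
      exact key
    refine this.trans (le_of_eq ?_)
    rw [← ENNReal.ofReal_div_of_pos hpos, div_eq_mul_inv, ← Real.exp_neg, neg_sub]
  refine nonpos_iff_eq_zero.mp (ENNReal.le_of_forall_pos_le_add fun ε hε _ => ?_)
  rw [zero_add]
  -- choose `t` with `M e^{N - tδ} ≤ ε`
  have hM : ∀ t : ℝ, 1 < t → M * Real.exp (N - t * δ) ≤ |M| * Real.exp (N - t * δ) := fun t _ =>
    mul_le_mul_of_nonneg_right (le_abs_self M) (Real.exp_pos _).le
  obtain ⟨t, ht1, ht⟩ : ∃ t : ℝ, 1 < t ∧ |M| * Real.exp (N - t * δ) ≤ ε := by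
    rcases eq_or_ne (|M|) 0 with h0 | h0
    · exact ⟨2, by norm_num, by rw [h0, zero_mul]; exact hε.le⟩
    have hMpos : 0 < |M| := lt_of_le_of_ne (abs_nonneg M) (Ne.symm h0)
    refine ⟨max 2 ((N - Real.log (ε / |M|)) / δ + 1), ?_, ?_⟩
    · have := le_max_left (2 : ℝ) ((N - Real.log (ε / |M|)) / δ + 1); linarith
    · set t := max 2 ((N - Real.log (ε / |M|)) / δ + 1)
      have ht : (N - Real.log (ε / |M|)) / δ < t := by
        have := le_max_right (2 : ℝ) ((N - Real.log (ε / |M|)) / δ + 1); linarith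
      rw [div_lt_iff₀ hδ] at ht
      have hexp : Real.exp (N - t * δ) ≤ ε / |M| := by
        calc Real.exp (N - t * δ) ≤ Real.exp (Real.log (ε / |M|)) := Real.exp_le_exp.2 (by linarith)
          _ = ε / |M| := Real.exp_log (div_pos (by exact_mod_cast hε) hMpos)
      calc |M| * Real.exp (N - t * δ) ≤ |M| * (ε / |M|) := mul_le_mul_of_nonneg_left hexp hMpos.le
        _ = ε := mul_div_cancel₀ _ h0
  calc μ B ≤ ENNReal.ofReal (M * Real.exp (N - t * δ)) := hle t ht1
    _ ≤ ENNReal.ofReal (|M| * Real.exp (N - t * δ)) := ENNReal.ofReal_le_ofReal (hM t ht1)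
    _ ≤ ENNReal.ofReal (ε : ℝ) := ENNReal.ofReal_le_ofReal ht
    _ = ε := ENNReal.ofReal_coe_nnreal

/-- **The `t → ∞` step for measures.** A positive Borel measure on `ℝ × ℝ ∋ (E, p)` whose Laplace
transforms `∫ e^{−tE−σp} dμ` are bounded by one constant on `{|σ| < t}` charges nothing outside the
cone: `μ {E < |p|} = 0`. (Apply to the joint spectral measure of `(H,P₁)` in `Ψ_F`; the bound is the
real section of the conclusion's Cauchy–Schwarz inequality. Conversely this is why every
cone-violating model automatically violates the typed bound.) [folklore] -/
theorem cone_of_laplace_bound (μ : Measure (ℝ × ℝ)) (M : ℝ)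
    (h : ∀ t σ : ℝ, |σ| < t →
      ∫⁻ x, ENNReal.ofReal (Real.exp (-(t * x.1) - σ * x.2)) ∂μ ≤ ENNReal.ofReal M) :
    μ {x : ℝ × ℝ | x.1 < |x.2|} = 0 := by
  -- the mirrored measure (p ↦ -p) satisfies the same bound
  have hneg : ∀ t σ : ℝ, |σ| < t →
      ∫⁻ x, ENNReal.ofReal (Real.exp (-(t * x.1) - σ * x.2)) ∂(μ.map fun x : ℝ × ℝ => (x.1, -x.2)) ≤
        ENNReal.ofReal M := by
    intro t σ hσ
    have hmeas : Measurable fun x : ℝ × ℝ => ENNReal.ofReal (Real.exp (-(t * x.1) - σ * x.2)) :=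
      (((measurable_fst.const_mul t).neg).sub (measurable_snd.const_mul σ)).exp.ennreal_ofReal
    have hf : Measurable fun x : ℝ × ℝ => (x.1, -x.2) := measurable_fst.prodMk measurable_snd.neg
    rw [lintegral_map hmeas hf]
    have := h t (-σ) (by rwa [abs_neg])
    simpa [neg_mul, mul_neg] using this
  -- cover `{E < |p|}` by countably many slabs and mirrored slabs
  have hcover : {x : ℝ × ℝ | x.1 < |x.2|} ⊆
      ⋃ k : ℕ, ⋃ N : ℕ, ({x : ℝ × ℝ | x.1 ≤ x.2 - 1 / ((k : ℝ) + 1) ∧ x.2 ≤ N} ∪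
        {x : ℝ × ℝ | x.1 ≤ -x.2 - 1 / ((k : ℝ) + 1) ∧ -x.2 ≤ N}) := by
    intro x hx
    simp only [Set.mem_setOf_eq] at hx
    obtain ⟨k, hk⟩ := exists_nat_one_div_lt (by linarith : 0 < |x.2| - x.1)
    obtain ⟨N, hN⟩ := exists_nat_ge |x.2|
    simp only [Set.mem_iUnion, Set.mem_union, Set.mem_setOf_eq]
    refine ⟨k, N, ?_⟩
    rcases le_or_gt 0 x.2 with hp | hp
    · left; rw [abs_of_nonneg hp] at hk hN; constructor <;> linarith
    · right; rw [abs_of_neg hp] at hk hN; constructor <;> linarith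
  refine measure_mono_null hcover (measure_iUnion_null fun k => measure_iUnion_null fun N => ?_)
  have hk : (0 : ℝ) < 1 / ((k : ℝ) + 1) := by positivity
  refine measure_union_null (slab_null_of_laplace_bound μ M h hk N) ?_
  -- mirrored slab: pull back through `p ↦ -p`
  have hm := slab_null_of_laplace_bound (μ.map fun x : ℝ × ℝ => (x.1, -x.2)) M hneg hk N
  have hS : MeasurableSet {x : ℝ × ℝ | x.1 ≤ x.2 - 1 / ((k : ℝ) + 1) ∧ x.2 ≤ (N : ℝ)} :=
    (measurableSet_le measurable_fst (measurable_snd.sub measurable_const)).inter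
      (measurableSet_le measurable_snd measurable_const)
  have hf : Measurable fun x : ℝ × ℝ => (x.1, -x.2) := measurable_fst.prodMk measurable_snd.neg
  rw [Measure.map_apply hf hS] at hm
  exact hm

end Summit.QuantumFields.YangMills.Cruxes.PlanarSpectralCone.Disproof

end
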